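import Literature.NumberTheory.EllipticCurves.Sprung2012.ColemanMaps
import Literature.Algebra.Module.PadicPairingFamilies
import HarnessLib

/-!
# Route `ByReductionTypeAtTwo` (rung K4), crux `SupersingularRankZeroAtTwo` (item stmt-BirchSwinnertonDyer-19097), stub 5
# `stub_flatKernelCyclic` (hand h13), sub-hand h13b, brick (K3): **INDEPENDENCE OF THE KUMMER REPRESENTATIVE** — two Kummer
# data `(φ, Q, k)`, `(φ', Q', k')` of the SAME class `c ∈ H¹(K_∞, E[p^∞])` at the place `ι` give the same pairing character
# `z ↦ z(p^kQ)/p^k = z(p^{k'}Q')/p^{k'}` on ALL functionals `z : E(K_∞·K_v) →+ ℤ_p` (cell `bsd-2adic`, seat `bsd-2adic-t42` GEN 44;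
# `--supports 19097`, helper; sequel of `…FlatKummerRepresentative` (K2) and `…FlatKummerCharacterLocal` (K1))

HONEST FRAMING (D-0036/D-0054): THEOREMS ONLY (no definition, no named fact, no `sorry`, no instance); generic `K`, `p`, `κ`, `ι`, `W`.
MECHANISM: `φ − φ'` is a coboundary `h ↦ h v − v` (`v ∈ E[p^∞]`, `oneCocycleClass_eq_zero_iff`); restricted to `Gal(K̄_v/K_∞·K_v)` it reads
`τ(Q − Q' − ι v) = Q − Q' − ι v`, so `D := Q − Q' − ι v ∈ E(K_∞·K_v)`; then `p^K (Q − Q') = p^K D + (torsion)` in `E(K_∞·K_v)` and every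
`ℤ_p`-valued functional kills torsion, whence `p^K ∣ z(p^K(Q − Q'))` and the two pairing characters agree
(`padicPairingFamily_eq_iff`, levels equalised by `padicPairingFamily_pow_nsmul_left`).  So the Kummer injection `j : Sel_∞ → Λ^∨`
(`j s = (e x k) ∘ (f ↦ f • z♭)`) is WELL DEFINED on classes.  Equivariance and `ker j = Sel♭` are NOT here.  19097 OPEN; BSD proved for no curve.

References: [Kobayashi2003] §2 p. 4 (the Kummer map `E(K_{n,v}) ⊗ ℚ_p/ℤ_p ↪ H¹`); [Sprung2012] Lemma 7.10, Def. 7.9; [NeukirchSchmidtWingberg2008] I §1 (1.1.8).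
-/

set_option autoImplicit false
-- the Theorems namespace of this sub repeats the summit name by design (D-0017 nested layout)
set_option linter.dupNamespace false

noncomputable section

open scoped Classical

universe u

namespace Summit.BirchSwinnertonDyer.BirchSwinnertonDyer.Theorems

namespace OddBlindNF

open WeierstrassCurve Literature.NumberTheory.EllipticCurves Literature.NumberTheory.EllipticCurves.Sprung2012
  Literature.NumberTheory.EllipticCurves.Sprung2017 Literature.NumberTheory.EllipticCurves.Kobayashi2003
  Literature.NumberTheory.GaloisRepresentations Literature.Algebra.Module ZpExtension

variable {K : Type u} [Field K] {p : ℕ} [hp : Fact p.Prime] {κ : ZpExtension K p}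
variable {E : Type u} [Field E] [Algebra K E] {ι : AlgebraicClosure K →ₐ[K] AlgebraicClosure E} {W : WeierstrassCurve K}

/-- A `ℤ_p`-valued functional kills torsion points. [folklore] -/
theorem apply_eq_zero_of_nsmul_eq_zero (z : localTowerPointsOfEmb κ ι W →+ ℤ_[p]) {t : localTowerPointsOfEmb κ ι W} {m : ℕ}
    (ht : p ^ m • t = 0) : z t = 0 := by
  have h : p ^ m • z t = 0 := by rw [← map_nsmul, ht, map_zero]
  rw [nsmul_eq_mul] at h
  rcases mul_eq_zero.mp h with h0 | h0
  · exact absurd h0 (by exact_mod_cast pow_ne_zero m hp.out.ne_zero)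
  · exact h0

/-- **Two Kummer data of the same class differ by `E(K_∞·K_v)` and torsion**: if `φ`, `φ'` represent the same class and restrict on
`Gal(K̄_v/K_∞·K_v)` to the Kummer cocycles of `Q`, `Q'`, then `Q − Q' − ι v ∈ E(K_∞·K_v)` for some `v ∈ E[p^∞]`.
[cite: Kobayashi2003, §2 p. 4] -/
theorem exists_sub_sub_mem_localTowerPointsOfEmb
    {φ φ' : contOneCocycles.{0, u} (discreteTopRep κ.kerSubgroup (W.geomPrimaryTorsion p))} {Q Q' : localPoints W E}
    (hφ : oneCocycleClass (discreteTopRep κ.kerSubgroup (W.geomPrimaryTorsion p)) φ =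
      oneCocycleClass (discreteTopRep κ.kerSubgroup (W.geomPrimaryTorsion p)) φ')
    (hτ : ∀ τ : localSubgroupOfEmb κ.kerSubgroup ι,
      pointsMapOfEmb W ι ((φ.1 (resGalSubgroupOfEmb κ.kerSubgroup ι τ) : W.geomPrimaryTorsion p) : W.geomPoints) =
        (τ : Field.absoluteGaloisGroup E) • Q - Q)
    (hτ' : ∀ τ : localSubgroupOfEmb κ.kerSubgroup ι,
      pointsMapOfEmb W ι ((φ'.1 (resGalSubgroupOfEmb κ.kerSubgroup ι τ) : W.geomPrimaryTorsion p) : W.geomPoints) =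
        (τ : Field.absoluteGaloisGroup E) • Q' - Q') :
    ∃ v : W.geomPrimaryTorsion p, Q - Q' - pointsMapOfEmb W ι (v : W.geomPoints) ∈ localTowerPointsOfEmb κ ι W := by
  have h0 : oneCocycleClass (discreteTopRep κ.kerSubgroup (W.geomPrimaryTorsion p)) (φ - φ') = 0 := by
    rw [← oneCocycleClassₗ_apply, map_sub, oneCocycleClassₗ_apply, oneCocycleClassₗ_apply, hφ, sub_self]
  obtain ⟨v, hv⟩ := (oneCocycleClass_eq_zero_iff _ _).mp h0
  refine ⟨v, (mem_localTowerPointsOfEmb_iff κ ι W _).mpr fun τ hτmem ↦ ?_⟩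
  have h1 := hv (resGalSubgroupOfEmb κ.kerSubgroup ι ⟨τ, hτmem⟩)
  -- read the coboundary identity in `E(K̄_v)`
  have h2 : pointsMapOfEmb W ι (((φ - φ').1 (resGalSubgroupOfEmb κ.kerSubgroup ι ⟨τ, hτmem⟩) : W.geomPrimaryTorsion p) :
      W.geomPoints) = (τ • Q - Q) - (τ • Q' - Q') := by
    rw [Submodule.coe_sub, ContinuousMap.sub_apply, AddSubgroup.coe_sub, map_sub, hτ ⟨τ, hτmem⟩, hτ' ⟨τ, hτmem⟩]
  have h3 : pointsMapOfEmb W ι (((φ - φ').1 (resGalSubgroupOfEmb κ.kerSubgroup ι ⟨τ, hτmem⟩) : W.geomPrimaryTorsion p) :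
      W.geomPoints) = τ • pointsMapOfEmb W ι (v : W.geomPoints) - pointsMapOfEmb W ι (v : W.geomPoints) := by
    rw [h1]
    change pointsMapOfEmb W ι (((resGalSubgroupOfEmb κ.kerSubgroup ι ⟨τ, hτmem⟩ • v - v : W.geomPrimaryTorsion p) :
      W.geomPoints)) = _
    rw [AddSubgroup.coe_sub, map_sub, Subgroup.smul_def, resGalSubgroupOfEmb_apply_coe,
      Literature.NumberTheory.EllipticCurves.primaryComponent.coe_smul, pointsMapOfEmb_smul]
  rw [h2] at h3
  rw [smul_sub, smul_sub]
  have : τ • Q - τ • Q' - τ • pointsMapOfEmb W ι (v : W.geomPoints) - (Q - Q' - pointsMapOfEmb W ι (v : W.geomPoints)) = 0 := by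
    have h4 : (τ • Q - Q) - (τ • Q' - Q') - (τ • pointsMapOfEmb W ι (v : W.geomPoints) - pointsMapOfEmb W ι (v : W.geomPoints)) = 0 := by
      rw [h3, sub_self]
    rw [← h4]; abel
  exact sub_eq_zero.mp this

/-- **INDEPENDENCE OF THE KUMMER REPRESENTATIVE.**  For a pairing-character family `e` on `E(K_∞·K_v)` and two Kummer data
`(φ, Q, k)`, `(φ', Q', k')` of the same class (same `oneCocycleClass`; restrictions = Kummer cocycles of `Q`, `Q'`; `p^kQ, p^{k'}Q' ∈ E(K_∞·K_v)`):
`e (p^k Q) k = e (p^{k'} Q') k'` — the local Tate pairing with every functional depends only on the class.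
[cite: Kobayashi2003, §2 p. 4] [cite: Sprung2012, Def. 7.9 and Lemma 7.10 (p. 1503)] [cite: NeukirchSchmidtWingberg2008, I §1 (1.1.8)] -/
theorem padicPairingFamily_eq_of_kummerData
    {e : localTowerPointsOfEmb κ ι W → ℕ → ((localTowerPointsOfEmb κ ι W →+ ℤ_[p]) →+ AddCircle (1 : ℚ))}
    (he : ∀ (x : localTowerPointsOfEmb κ ι W) (k : ℕ) (z : localTowerPointsOfEmb κ ι W →+ ℤ_[p]) (a : ℤ),
      PadicInt.toZModPow k (z x) = (a : ZMod (p ^ k)) → e x k z = (((a : ℚ) / (p : ℚ) ^ k : ℚ) : AddCircle (1 : ℚ)))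
    {φ φ' : contOneCocycles.{0, u} (discreteTopRep κ.kerSubgroup (W.geomPrimaryTorsion p))} {Q Q' : localPoints W E} {k k' : ℕ}
    (hφ : oneCocycleClass (discreteTopRep κ.kerSubgroup (W.geomPrimaryTorsion p)) φ =
      oneCocycleClass (discreteTopRep κ.kerSubgroup (W.geomPrimaryTorsion p)) φ')
    (hQ : (p ^ k) • Q ∈ localTowerPointsOfEmb κ ι W) (hQ' : (p ^ k') • Q' ∈ localTowerPointsOfEmb κ ι W)
    (hτ : ∀ τ : localSubgroupOfEmb κ.kerSubgroup ι,
      pointsMapOfEmb W ι ((φ.1 (resGalSubgroupOfEmb κ.kerSubgroup ι τ) : W.geomPrimaryTorsion p) : W.geomPoints) =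
        (τ : Field.absoluteGaloisGroup E) • Q - Q)
    (hτ' : ∀ τ : localSubgroupOfEmb κ.kerSubgroup ι,
      pointsMapOfEmb W ι ((φ'.1 (resGalSubgroupOfEmb κ.kerSubgroup ι τ) : W.geomPrimaryTorsion p) : W.geomPoints) =
        (τ : Field.absoluteGaloisGroup E) • Q' - Q') :
    e ⟨(p ^ k) • Q, hQ⟩ k = e ⟨(p ^ k') • Q', hQ'⟩ k' := by
  obtain ⟨v, hD⟩ := exists_sub_sub_mem_localTowerPointsOfEmb hφ hτ hτ'
  -- equalise the levels at `K = k' + k`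
  rw [← padicPairingFamily_pow_nsmul_left he ⟨(p ^ k) • Q, hQ⟩ k' k, ← padicPairingFamily_pow_nsmul_left he ⟨(p ^ k') • Q', hQ'⟩ k k',
    add_comm k k', padicPairingFamily_eq_iff he]
  intro z
  -- torsion of `v`
  obtain ⟨m, hm⟩ := AddCommGroup.mem_primaryComponent.mp v.2
  -- the difference in `E(K_∞·K_v)`: `p^K (Q − Q') = p^K D + p^K ι v`
  set D : localTowerPointsOfEmb κ ι W := ⟨_, hD⟩ with hDdef
  have hdiff : (p ^ k' • (⟨(p ^ k) • Q, hQ⟩ : localTowerPointsOfEmb κ ι W) - p ^ k • ⟨(p ^ k') • Q', hQ'⟩ : localTowerPointsOfEmb κ ι W) =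
      p ^ (k' + k) • D + (p ^ k' • ⟨(p ^ k) • Q, hQ⟩ - p ^ k • ⟨(p ^ k') • Q', hQ'⟩ - p ^ (k' + k) • D) := by abel
  set t : localTowerPointsOfEmb κ ι W := p ^ k' • ⟨(p ^ k) • Q, hQ⟩ - p ^ k • ⟨(p ^ k') • Q', hQ'⟩ - p ^ (k' + k) • D with htdef
  have htval : (t : localPoints W E) = p ^ (k' + k) • pointsMapOfEmb W ι (v : W.geomPoints) := by
    rw [htdef, hDdef]
    simp only [AddSubgroupClass.coe_sub, AddSubgroupClass.coe_nsmul]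
    rw [smul_sub, smul_sub, pow_add, mul_smul, mul_smul, smul_comm (p ^ k) (p ^ k') Q']
    abel
  have ht : p ^ m • t = 0 := by
    apply Subtype.ext
    rw [AddSubgroupClass.coe_nsmul, htval, ZeroMemClass.coe_zero, smul_comm, ← map_nsmul, hm, map_zero, smul_zero]
  rw [hdiff, map_add, apply_eq_zero_of_nsmul_eq_zero z ht, add_zero, map_nsmul, nsmul_eq_mul, Nat.cast_pow]
  exact dvd_mul_right _ _

end OddBlindNF

end Summit.BirchSwinnertonDyer.BirchSwinnertonDyer.Theorems

end
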